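import Summits.BirchSwinnertonDyer.Rank1Residual.P2.TransportAtTwo
import Literature.NumberTheory.EllipticCurves.ShuZhai2021.GeneralizedBirchLemma
import HarnessLib

/-!
# Sub-lane «bsd-p2»: TRANSPORT AT `2`, sequel — the P2 consumer of Shu–Zhai 2021 (Crelle 775)
# Thm 1.2 / Thm 1.4 (rank ZERO twist `E^{(M)}` AND rank ONE twist `E^{(−pM)}`):
# `BSD(E^{(M)}, 2)` and `BSD(E^{(−pM)}, 2)` from a certified base `BSD(E, 2)`, with a GZK-free bridge

HONEST FRAMING (sub-lane «bsd-p2», run/shared/lean/b2b/bsd-rank1-residual/p2/, verbatim in every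
file): the target of record is the FULL Birch–Swinnerton-Dyer formula for EVERY analytic-rank `≤ 1`
`E/ℚ` at ALL primes INCLUDING `2`; the odd-prime class ledger is referee A's; the `2`-part is OPEN
(cells O1 = X5 ∖ CM and O12 = the CM corner) and under census by «bsd-p2». Census / instrument
output at `2` = EVIDENCE / conjecture items with held-out validation, NEVER a Literature fact;
certificates close PAIRS (one isogeny class, `p = 2`), never classes. This file asserts NO
arithmetic fact: its inputs are the AS-PRINTED named facts of p2-lit-1's
`ShuZhai2021/GeneralizedBirchLemma.lean` (p311476; `thm12_ranks_of_twists`,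
`thm14_twoPartBSD_of_twists`, nothing asserted), modularity (`hasEntireLFunction_rat`, for
`L^{(r)}(·,1) ≠ 0 ⟺ r = r_an`), and a CERTIFIED-BASE hypothesis `BSDp W 2` for the curve being
twisted; all explicit binders. NO Gross–Zagier–Kolyvagin binder: Thm 1.2 prints the rank
equalities and the finiteness of `Ш` for `E`, `E^{(M)}`, `E^{(−pM)}`, and §0 below converts print
shape ⟷ Miller's `BSDp` from those data directly. The lead's census word for a pair closed this
way is `TRANSPORTED:<thm>:<base>:<d>` (LEAD-OKS I2-2), DISTINCT from `CERTIFIED`; this file is its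
kernel shape for `<thm> = SZ14`. Nothing booked; no mark moved. Unit `b2b-bsdres-p2-typer` GEN 2
(gen-1 HANDOFF NEXT (2): "SZ21 / Zh21 consumers … when lit-1's as-printed files land"; LEAD-OKS
I2-8; a NEW file — `TransportAtTwo.lean` untouched, append-only rule and 400-line cap). Sequel
`P2/CountsAtTwo.lean`: Shu–Zhai Thm 4.10 and Zhai 2021 Thm 5.2, where print gives the EXACT
`2`-adic valuation of `L^{(r)}/(Ω R)`, so `BSD(·,2)` of the pair is an explicit finite count.

## Contents

* §0 GZK-FREE BRIDGE `bsdp_iff_valuation_of_leadingLCoeff`: for an elliptic `V/ℚ` with FINITE `Ш`,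
  `rank E(ℚ) = r_an`, and `L^{(r_an)}(E,1)/r_an! = x·Ω·R` with `x ∈ ℚˣ`, Miller's `BSDp V p` is
  EQUIVALENT to `ord_p x = ord_p #Ш + ord_p ∏ c_ℓ − 2·ord_p #E(ℚ)_tor` (`#Ш_an = x·#tor²/∏ c_ℓ`).
  Corollaries `bsdp_of_pPart_of_finite` / `pPart_of_bsdp_of_finite` (the tree's `bsdp_of_pPart` /
  `pPart_of_bsdp` with the GZK binder replaced by the two data it was used for).
* §1 SHU–ZHAI Thm 1.2: the BASE of the setting has analytic rank `0`, rank `0` and finite `Ш`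
  (`base_rankZero_of_shuZhai`: Thm 1.2 at `r = 0`, `M = 1`, `E^{(1)} ≅ E` by
  `exists_variableChange_quadraticTwist_one`) — derived, not assumed.
* §2 SHU–ZHAI Thm 1.4 TRANSPORT (pair form `bsdp_two_twists_of_shuZhai`, census word
  `TRANSPORTED:SZ14`): setting of Thm 1.2 + (i) odd Manin constant + (ii) every `ℓ ∣ 2N` split in
  `ℚ(√−p)` and `ℚ(√M)` + CERTIFIED BASE `BSDp W 2` ⇒ `BSDp WM 2` (analytic rank `0`) AND
  `BSDp WpM 2` (analytic rank `1`) — the first RANK-ONE transport at `2` in the P2 layer; family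
  forms `bsdTwoOn_twistFamily_shuZhai_rankZero/…_rankOne` on `TwistFamilyAtTwo W (SZParam… )`.
* Grid placement: the rank bits (`r0` for `E^{(M)}`, `r1` for `E^{(−pM)}`, `rankBits_twists_of_shuZhai`);
  image / reduction / CM bits are not pinned here (the `E[2] ≅ E^{(d)}[2]` lemma is not in the
  tree; gen-1 HANDOFF (4)).

References: Shu–Zhai, J. reine angew. Math. 775 (2021) 117–143, Thm 1.2 / 1.4 [ShuZhai2021];
Miller 2011 Def 1.1 [Miller2011LMS]; Cai–Li–Zhai 2020 §1 (fbsd) [CaiLiZhai2019]; Silverman AEC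
VIII.8 Cor 8.3, III.1 [SilvermanAEC2009]; HOME/p2/LEAD-OKS.md I2-2/I2-8/L-OW; HOME/p2/LIT-STATUS.md
§T1 rows T1-S1…S3.
-/

noncomputable section

open scoped Classical MatrixGroups ModularForm

open CongruenceSubgroup NumberField WeierstrassCurve Literature.NumberTheory.EllipticCurves
  Literature.NumberTheory.EllipticCurves.ModularForms
  Literature.NumberTheory.EllipticCurves.Rank1Residual
  Literature.NumberTheory.EllipticCurves.Rank1Residual.Typed

set_option autoImplicit false

namespace Summit.BirchSwinnertonDyer.Rank1Residual.P2

/-! ## §0 The GZK-free bridge: exact analytic data ⟷ Miller's `BSD(E,p)` -/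

section Bridge

variable (V : WeierstrassCurve ℚ) [V.IsElliptic] (p : ℕ) [Fact p.Prime]

omit [Fact p.Prime] in
/-- If `L^{(r_an)}(E,1)/r_an! = x·Ω·R` with `x ∈ ℚ`, then Miller's analytic order of `Ш` is the
rational number `#Ш_an = x·#E(ℚ)_tor²/∏ c_ℓ` (`Ω, R, ∏ c_ℓ > 0`).
[cite: Miller2011LMS, §1 (arXiv:1010.2431 p. 3: definition of #Ш_an)] -/
theorem shaAn_eq_of_leadingLCoeff {x : ℚ}
    (hL : V.leadingLCoeff = (x : ℂ) * (V.realPeriodRat : ℂ) * (V.regulator : ℂ)) :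
    shaAn V = ((x * (V.torsionOrder : ℚ) ^ 2 / (V.tamagawaProduct : ℚ) : ℚ) : ℂ) := by
  have hΩ : (V.realPeriodRat : ℂ) ≠ 0 := by exact_mod_cast V.realPeriodRat_pos_holds.ne'
  have hR : (V.regulator : ℂ) ≠ 0 := by exact_mod_cast V.regulator_pos'.ne'
  have hc : (V.tamagawaProduct : ℂ) ≠ 0 := by exact_mod_cast V.tamagawaProduct_pos_holds.ne'
  rw [shaAn_def, hL]
  push_cast
  field_simp

/-- **GZK-FREE BRIDGE.** For an elliptic `V/ℚ` with finite `Ш`, `rank E(ℚ) = r_an` and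
`L^{(r_an)}(E,1)/r_an! = x·Ω·R` with `x ∈ ℚ`, `x ≠ 0`: Miller's `BSD(E,p)` (`BSDp V p`) is EQUIVALENT
to the valuation identity `ord_p x = ord_p #Ш + ord_p ∏ c_ℓ − 2·ord_p #E(ℚ)_tor` (clauses (i)(ii) of
`BSDp` are the data; (iii) `#Ш_an = x·#tor²/∏ c_ℓ ∈ ℚ`; (iv) `ord_p #Ш(p) = ord_p #Ш` for finite `Ш`,
`padicValNat_card_addPrimaryComponent`). The tree's `bsdp_of_pPart` / `pPart_of_bsdp` take
Gross–Zagier–Kolyvagin for exactly these two data; here they are binders, so a printed theorem that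
states them (Shu–Zhai Thm 1.2 / 4.10, Zhai Thm 5.2) is consumed with no GZK hypothesis.
[cite: Miller2011LMS, Def. 1.1 (arXiv:1010.2431 p. 3)] -/
theorem bsdp_iff_valuation_of_leadingLCoeff [Finite V.sha]
    (hrank : V.mordellWeilRank = V.analyticRank) {x : ℚ} (hx : x ≠ 0)
    (hL : V.leadingLCoeff = (x : ℂ) * (V.realPeriodRat : ℂ) * (V.regulator : ℂ)) :
    BSDp V p ↔ padicValRat p x = (padicValNat p (Nat.card V.sha) : ℤ) +
      padicValNat p V.tamagawaProduct - 2 * padicValNat p V.torsionOrder := by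
  have hsha := shaAn_eq_of_leadingLCoeff V hL
  have ht : (V.torsionOrder : ℚ) ≠ 0 := by exact_mod_cast V.torsionOrder_pos_holds.ne'
  have hc : (V.tamagawaProduct : ℚ) ≠ 0 := by exact_mod_cast V.tamagawaProduct_pos_holds.ne'
  have hval : padicValRat p (x * (V.torsionOrder : ℚ) ^ 2 / (V.tamagawaProduct : ℚ)) =
      padicValRat p x + 2 * padicValNat p V.torsionOrder - padicValNat p V.tamagawaProduct := by
    rw [padicValRat.div (mul_ne_zero hx (pow_ne_zero 2 ht)) hc, padicValRat.mul hx (pow_ne_zero 2 ht),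
      padicValRat.pow (V.torsionOrder : ℚ), padicValRat.of_nat, padicValRat.of_nat]
    push_cast
    ring
  have hprim : padicValNat p (Nat.card (AddCommGroup.primaryComponent V.sha p)) =
      padicValNat p (Nat.card V.sha) := padicValNat_card_addPrimaryComponent p
  constructor
  · rintro ⟨-, -, q, hq, hv⟩
    have hqx : q = x * (V.torsionOrder : ℚ) ^ 2 / (V.tamagawaProduct : ℚ) := by
      exact_mod_cast hq.symm.trans hsha
    subst hqx
    rw [hval, hprim] at hv
    linarith
  · intro hv
    refine ⟨hrank, Finite.of_injective _ Subtype.val_injective, _, hsha, ?_⟩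
    rw [hval, hprim, hv]
    ring

/-- The cell's print shape `PPart V p` gives `BSDp V p` from FINITE `Ш` and `rank = r_an` as data
(modularity `hmod` for `L^{(r)}(E,1) ≠ 0`); the tree's `bsdp_of_pPart` with its GZK binder replaced
by what it was used for. [cite: Miller2011LMS, §1 and Def. 1.1] -/
theorem bsdp_of_pPart_of_finite (hmod : hasEntireLFunction_rat) [Finite V.sha]
    (hrank : V.mordellWeilRank = V.analyticRank) (h : PPart V p) : BSDp V p := by
  obtain ⟨q, hq, hv⟩ := h
  have hΩR : ((V.realPeriodRat * V.regulator : ℝ) : ℂ) ≠ 0 := by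
    exact_mod_cast (mul_pos V.realPeriodRat_pos_holds V.regulator_pos').ne'
  have hL : V.leadingLCoeff = (q : ℂ) * (V.realPeriodRat : ℂ) * (V.regulator : ℂ) := by
    rw [← div_mul_cancel₀ V.leadingLCoeff hΩR, hq]
    push_cast
    ring
  have hq0 : q ≠ 0 := by
    rintro rfl
    exact V.leadingLCoeff_ne_zero_holds (hmod V) (by rw [hL]; simp)
  exact (bsdp_iff_valuation_of_leadingLCoeff V p hrank hq0 hL).2 (by rw [hv, WeierstrassCurve.shaOrder])

/-- Conversely `BSDp V p` gives the print shape from finite `Ш` (the tree's `pPart_of_bsdp` without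
its GZK binder; `rank = r_an` is clause (i) of `BSDp`). [cite: Miller2011LMS, §1 and Def. 1.1] -/
theorem pPart_of_bsdp_of_finite (hmod : hasEntireLFunction_rat) [Finite V.sha] (h : BSDp V p) :
    PPart V p := by
  obtain ⟨hrank, hfinp, q, hq, hv⟩ := h
  -- `L^{(r)}(E,1)/(Ω R)` is the rational `#Ш_an · ∏ c_ℓ / #tor²`
  have hc : (V.tamagawaProduct : ℂ) ≠ 0 := by exact_mod_cast V.tamagawaProduct_pos_holds.ne'
  have htor : (V.torsionOrder : ℂ) ≠ 0 := by exact_mod_cast V.torsionOrder_pos_holds.ne'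
  have hΩ : (V.realPeriodRat : ℂ) ≠ 0 := by exact_mod_cast V.realPeriodRat_pos_holds.ne'
  have hR : (V.regulator : ℂ) ≠ 0 := by exact_mod_cast V.regulator_pos'.ne'
  set x : ℚ := q * (V.tamagawaProduct : ℚ) / (V.torsionOrder : ℚ) ^ 2 with hxdef
  have hL : V.leadingLCoeff = (x : ℂ) * (V.realPeriodRat : ℂ) * (V.regulator : ℂ) := by
    have : V.leadingLCoeff = (q : ℂ) * ((V.realPeriodRat : ℂ) * (V.tamagawaProduct : ℂ) *
        (V.regulator : ℂ)) / (V.torsionOrder : ℂ) ^ 2 := by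
      rw [← hq, shaAn_def]
      field_simp
    rw [this, hxdef]
    push_cast
    field_simp
  have hx0 : x ≠ 0 := by
    intro h0
    exact V.leadingLCoeff_ne_zero_holds (hmod V) (by rw [hL, h0]; simp)
  refine ⟨x, ?_, ?_⟩
  · rw [hL]
    push_cast
    field_simp
  · rw [(bsdp_iff_valuation_of_leadingLCoeff V p hrank hx0 hL).1 ⟨hrank, hfinp, q, hq, hv⟩,
      WeierstrassCurve.shaOrder]

end Bridge

/-! ## §1 Shu–Zhai 2021 Thm 1.2: the base of the setting has analytic rank `0` -/

section SZ

open Literature.NumberTheory.EllipticCurves.ShuZhai2021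

variable {W : WeierstrassCurve ℚ} [W.IsElliptic] [W.IsGloballyMinimal] [NeZero (W.conductorNorm ℤ)]
  {Dt : ModularParametrizationData W (W.conductorNorm ℤ)} {W' : WeierstrassCurve ℚ} {p : ℕ}
  {Q : Finset ℕ}

omit [W.IsElliptic] [W.IsGloballyMinimal] in
/-- The setting of Thm 1.2 with `r = 0` admissible primes (`M = 1`) is contained in the setting with
any `Q` ("for any integer `r ≥ 0`"). [cite: ShuZhai2021, Thm. 1.2 (arXiv:2102.11808 chunk p0003 L25)] -/
theorem thm12Setting_empty (hS : Thm12Setting W Dt W' p Q) : Thm12Setting W Dt W' p ∅ := by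
  obtain ⟨h1, h2, h3, h4, h5, h6, h7, h8, h9, -⟩ := hS
  exact ⟨h1, h2, h3, h4, h5, h6, h7, h8, h9, fun q hq => absurd hq (Finset.notMem_empty q)⟩

omit [W.IsElliptic] [W.IsGloballyMinimal] in
/-- In the setting of Thm 1.2 the prime `p` is nonzero (as a rational twisting parameter `−p·M`).
[cite: ShuZhai2021, §1 (chunk p0003 L22: "p will always denote a prime > 3")] -/
theorem neg_p_mul_ne_zero_of_thm12Setting (hS : Thm12Setting W Dt W' p Q) (Q₀ : Finset ℕ)
    (hQ₀ : ∀ q ∈ Q₀, (q : ℤ) ≠ 0) :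
    ((-(p : ℤ) * ∏ q ∈ Q₀, qStar q : ℤ) : ℚ) ≠ 0 := by
  have hp : (p : ℤ) ≠ 0 := by exact_mod_cast hS.2.2.2.2.2.1.ne_zero
  have hprod : (∏ q ∈ Q₀, qStar q : ℤ) ≠ 0 := by
    rw [Finset.prod_ne_zero_iff]
    intro q hq
    unfold qStar
    split_ifs
    · exact hQ₀ q hq
    · exact neg_ne_zero.mpr (hQ₀ q hq)
  exact_mod_cast mul_ne_zero (neg_ne_zero.mpr hp) hprod

/-- **The base has analytic rank `0`, rank `0` and finite `Ш`** (Shu–Zhai Thm 1.2 at `r = 0`: then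
`M = 1` and `E^{(1)} ≅ E` over `ℚ` — the completing-the-square isomorphism
`exists_variableChange_quadraticTwist_one`; `W` is its own globally minimal model; a globally minimal
model of the companion `E^{(−p)}` exists, Silverman VIII.8 Cor 8.3, its conclusions are dropped).
Derived from the printed theorem, not assumed; in print this is "`f([0]) ∉ 2E(ℚ)` forces
`L(E,1) ≠ 0`". [cite: ShuZhai2021, Thm. 1.2 (arXiv:2102.11808 chunk p0003 L24–L32)] -/
theorem base_rankZero_of_shuZhai (h12 : thm12_ranks_of_twists) (hS : Thm12Setting W Dt W' p Q) :
    W.analyticRank = 0 ∧ W.mordellWeilRank = 0 ∧ Finite W.sha := by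
  have hS0 := thm12Setting_empty hS
  have hM : ∃ C : VariableChange ℚ,
      C • W.quadraticTwist ((∏ q ∈ (∅ : Finset ℕ), qStar q : ℤ) : ℚ) = W := by
    rw [Finset.prod_empty, Int.cast_one]
    exact exists_smul_eq_comm.1 W.exists_variableChange_quadraticTwist_one
  have hd : ((-(p : ℤ) * ∏ q ∈ (∅ : Finset ℕ), qStar q : ℤ) : ℚ) ≠ 0 :=
    neg_p_mul_ne_zero_of_thm12Setting hS ∅ (fun q hq => absurd hq (Finset.notMem_empty q))
  obtain ⟨WpM, _, _, hWpM⟩ := exists_globallyMinimal_twist W hd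
  obtain ⟨hr, hrk, -, -, hfin, -⟩ := h12 W Dt W' p ∅ hS0 W WpM hM hWpM
  exact ⟨hr, hrk, hfin⟩

/-! ## §2 Shu–Zhai 2021 Thm 1.4: `BSD(E^{(M)},2)` and `BSD(E^{(−pM)},2)` from a certified base -/

/-- **`BSD(E^{(M)}, 2)` (analytic rank `0`) AND `BSD(E^{(−pM)}, 2)` (analytic rank `1`) FROM A
CERTIFIED BASE `BSD(E, 2)` (Shu–Zhai 2021 Thm 1.2 + Thm 1.4 at `2`, pair form).** Hypotheses
VERBATIM as typed by p2-lit-1 (binders): the setting of Thm 1.2 (`Thm12Setting W Dt W′ p Q`: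
`E[2](ℚ) ≅ ℤ/2ℤ` with `E′ = E/E[2](ℚ)` a degree-`2` isogeny image, `E` optimal, `f([0]) ∉ 2E(ℚ)`,
(Tor), `p > 3` prime, `p ≡ 3 (4)`, every `ℓ ∣ N` split in `ℚ(√−p)`, `Q` admissible primes `≠ p`,
`M = ∏ q*`); (i) odd Manin constant; (ii) every `ℓ ∣ 2N` split in `ℚ(√−p)` and in `ℚ(√M)`; `WM`,
`WpM` globally minimal models of `E^{(M)}`, `E^{(−pM)}`; the CERTIFIED BASE `BSDp W 2`; modularity.
Conclusion: `BSDp WM 2` with `r_an(E^{(M)}) = 0` and `BSDp WpM 2` with `r_an(E^{(−pM)}) = 1`. No GZK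
binder (Thm 1.2 prints ranks and finiteness for `E`, `E^{(M)}`, `E^{(−pM)}`). Census word for such a
pair: `TRANSPORTED:SZ14:<base>:<M or −pM>`.
[cite: ShuZhai2021, Thm. 1.2 and Thm. 1.4 (arXiv:2102.11808 chunk p0003 L24–L32, L44–L45)] -/
theorem bsdp_two_twists_of_shuZhai (h12 : thm12_ranks_of_twists) (h14 : thm14_twoPartBSD_of_twists)
    (hmod : hasEntireLFunction_rat) (hS : Thm12Setting W Dt W' p Q)
    {WM WpM : WeierstrassCurve ℚ} [WM.IsElliptic] [WM.IsGloballyMinimal] [WpM.IsElliptic]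
    [WpM.IsGloballyMinimal]
    (hM : ∃ C : VariableChange ℚ, C • W.quadraticTwist ((∏ q ∈ Q, qStar q : ℤ) : ℚ) = WM)
    (hpM : ∃ C : VariableChange ℚ,
      C • W.quadraticTwist ((-(p : ℤ) * ∏ q ∈ Q, qStar q : ℤ) : ℚ) = WpM)
    (hc : ¬ (2 : ℤ) ∣ Dt.c) (hK : AllPrimesSplitInSqrt (2 * W.conductorNorm ℤ) (-(p : ℤ)))
    (hQM : AllPrimesSplitInSqrt (2 * W.conductorNorm ℤ) (∏ q ∈ Q, qStar q)) (hbase : BSDp W 2) :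
    (WM.analyticRank = 0 ∧ BSDp WM 2) ∧ (WpM.analyticRank = 1 ∧ BSDp WpM 2) := by
  obtain ⟨-, -, hfinW⟩ := base_rankZero_of_shuZhai h12 hS
  haveI := hfinW
  have hPB : CaiLiZhai2019.pPartBSD W 2 :=
    (pPartBSD_iff_pPart W 2).2 (pPart_of_bsdp_of_finite W 2 hmod hbase)
  obtain ⟨hr0, hrk0, hr1, hrk1, hfinM, hfinpM⟩ := h12 W Dt W' p Q hS WM WpM hM hpM
  obtain ⟨hPBM, hPBpM⟩ := h14 W Dt W' p Q hS WM WpM hM hpM hc hK hQM hPB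
  haveI := hfinM
  haveI := hfinpM
  exact ⟨⟨hr0, bsdp_of_pPart_of_finite WM 2 hmod (by rw [hrk0, hr0]) ((pPartBSD_iff_pPart WM 2).1 hPBM)⟩,
    ⟨hr1, bsdp_of_pPart_of_finite WpM 2 hmod (by rw [hrk1, hr1]) ((pPartBSD_iff_pPart WpM 2).1 hPBpM)⟩⟩

/-- Grid placement of the two twists: rank bit `r0` for `E^{(M)}`, `r1` for `E^{(−pM)}` (Thm 1.2).
[cite: ShuZhai2021, Thm. 1.2 (arXiv:2102.11808 chunk p0003 L24–L32)] -/
theorem rankBits_twists_of_shuZhai (h12 : thm12_ranks_of_twists) (hS : Thm12Setting W Dt W' p Q)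
    {WM WpM : WeierstrassCurve ℚ} [WM.IsElliptic] [WM.IsGloballyMinimal] [WpM.IsElliptic]
    [WpM.IsGloballyMinimal]
    (hM : ∃ C : VariableChange ℚ, C • W.quadraticTwist ((∏ q ∈ Q, qStar q : ℤ) : ℚ) = WM)
    (hpM : ∃ C : VariableChange ℚ,
      C • W.quadraticTwist ((-(p : ℤ) * ∏ q ∈ Q, qStar q : ℤ) : ℚ) = WpM) :
    (cellAtTwoOf WM).r1 = false ∧ (cellAtTwoOf WpM).r1 = true := by
  obtain ⟨hr0, -, hr1, -, -, -⟩ := h12 W Dt W' p Q hS WM WpM hM hpM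
  constructor
  · show decide (WM.analyticRank = 1) = false
    rw [decide_eq_false_iff_not]; omega
  · show decide (WpM.analyticRank = 1) = true
    rw [decide_eq_true_iff]; exact hr1

/-- **The Shu–Zhai rank-ZERO twist parameters of a base** (for `TwistFamilyAtTwo`): `d = ∏_{q∈Q} q*`
for a finite set `Q` of admissible primes `≠ p` (relative to the model `W′` of `E′` and a prime `p`
of the setting) with every `ℓ ∣ 2N` split in `ℚ(√d)`.
[cite: ShuZhai2021, Thm. 1.2 / Thm. 1.4 hypotheses on M (chunk p0003 L25, L45)] -/
def SZParamRankZero (W W' : WeierstrassCurve ℚ) (p : ℕ) (d : ℚ) : Prop :=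
  ∃ Q : Finset ℕ, (∀ q ∈ Q, IsAdmissible W W' q ∧ q ≠ p) ∧
    AllPrimesSplitInSqrt (2 * W.conductorNorm ℤ) (∏ q ∈ Q, qStar q) ∧
    d = ((∏ q ∈ Q, qStar q : ℤ) : ℚ)

/-- **The Shu–Zhai rank-ONE twist parameters of a base**: `d = −p · ∏_{q∈Q} q*` with `Q` as in
`SZParamRankZero`. [cite: ShuZhai2021, Thm. 1.2 / Thm. 1.4 hypotheses on −pM (chunk p0003 L25, L45)] -/
def SZParamRankOne (W W' : WeierstrassCurve ℚ) (p : ℕ) (d : ℚ) : Prop :=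
  ∃ Q : Finset ℕ, (∀ q ∈ Q, IsAdmissible W W' q ∧ q ≠ p) ∧
    AllPrimesSplitInSqrt (2 * W.conductorNorm ℤ) (∏ q ∈ Q, qStar q) ∧
    d = ((-(p : ℤ) * ∏ q ∈ Q, qStar q : ℤ) : ℚ)

omit [W.IsElliptic] [W.IsGloballyMinimal] in
/-- Changing the admissible set `Q` inside the setting of Thm 1.2 (the `Q`-clause is the only one
that mentions `Q`). [cite: ShuZhai2021, Thm. 1.2 (chunk p0003 L25)] -/
theorem thm12Setting_of_forall (hS : Thm12Setting W Dt W' p Q) {Q₁ : Finset ℕ}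
    (hQ₁ : ∀ q ∈ Q₁, IsAdmissible W W' q ∧ q ≠ p) : Thm12Setting W Dt W' p Q₁ := by
  obtain ⟨h1, h2, h3, h4, h5, h6, h7, h8, h9, -⟩ := hS
  exact ⟨h1, h2, h3, h4, h5, h6, h7, h8, h9, hQ₁⟩

/-- **FAMILY FORM, rank zero.** For a base in the setting of Thm 1.2 (any `Q`, e.g. `∅`) with odd
Manin constant, every `ℓ ∣ 2N` split in `ℚ(√−p)`, and a CERTIFIED pair `(E, 2)`: the twist family
`TwistFamilyAtTwo W (SZParamRankZero W W′ p)` has its BSD-at-2 statement, granted Shu–Zhai Thm 1.2 /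
1.4 as printed and modularity. A covered one-parameter family INSIDE the open rank-`0` cells; it
never recolours a cell. [cite: ShuZhai2021, Thm. 1.2 and Thm. 1.4] -/
theorem bsdTwoOn_twistFamily_shuZhai_rankZero (h12 : thm12_ranks_of_twists)
    (h14 : thm14_twoPartBSD_of_twists) (hmod : hasEntireLFunction_rat)
    (hS : Thm12Setting W Dt W' p Q) (hc : ¬ (2 : ℤ) ∣ Dt.c)
    (hK : AllPrimesSplitInSqrt (2 * W.conductorNorm ℤ) (-(p : ℤ))) (hbase : BSDp W 2) :
    BSDTwoOn (TwistFamilyAtTwo W (SZParamRankZero W W' p)) := by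
  intro WM _ _ _ hWM
  obtain ⟨d, ⟨Q₁, hQ₁, hsplit, rfl⟩, C, hC⟩ := hWM
  have hS₁ := thm12Setting_of_forall hS hQ₁
  have hd : ((-(p : ℤ) * ∏ q ∈ Q₁, qStar q : ℤ) : ℚ) ≠ 0 :=
    neg_p_mul_ne_zero_of_thm12Setting hS Q₁ (fun q hq => by exact_mod_cast (hQ₁ q hq).1.1.ne_zero)
  obtain ⟨WpM, _, _, hWpM⟩ := exists_globallyMinimal_twist W hd
  exact (bsdp_two_twists_of_shuZhai h12 h14 hmod hS₁ ⟨C, hC⟩ hWpM hc hK hsplit hbase).1.2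

/-- **FAMILY FORM, rank one.** Same base-side hypotheses; the twist family
`TwistFamilyAtTwo W (SZParamRankOne W W′ p)` — globally minimal models of the `E^{(−pM)}`, all of
analytic rank `1` — has its BSD-at-2 statement, granted Shu–Zhai Thm 1.2 / 1.4 as printed and
modularity. A covered one-parameter family INSIDE the open rank-`1` cells, conditional on the base
pair's certificate. [cite: ShuZhai2021, Thm. 1.2 and Thm. 1.4] -/
theorem bsdTwoOn_twistFamily_shuZhai_rankOne (h12 : thm12_ranks_of_twists)
    (h14 : thm14_twoPartBSD_of_twists) (hmod : hasEntireLFunction_rat)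
    (hS : Thm12Setting W Dt W' p Q) (hc : ¬ (2 : ℤ) ∣ Dt.c)
    (hK : AllPrimesSplitInSqrt (2 * W.conductorNorm ℤ) (-(p : ℤ))) (hbase : BSDp W 2) :
    BSDTwoOn (TwistFamilyAtTwo W (SZParamRankOne W W' p)) := by
  intro WpM _ _ _ hWpM
  obtain ⟨d, ⟨Q₁, hQ₁, hsplit, rfl⟩, C, hC⟩ := hWpM
  have hS₁ := thm12Setting_of_forall hS hQ₁
  have hd : ((∏ q ∈ Q₁, qStar q : ℤ) : ℚ) ≠ 0 := by
    have h := neg_p_mul_ne_zero_of_thm12Setting hS Q₁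
      (fun q hq => by exact_mod_cast (hQ₁ q hq).1.1.ne_zero)
    push_cast at h ⊢
    exact (mul_ne_zero_iff.mp h).2
  obtain ⟨WM, _, _, hWM⟩ := exists_globallyMinimal_twist W hd
  exact (bsdp_two_twists_of_shuZhai h12 h14 hmod hS₁ hWM ⟨C, hC⟩ hc hK hsplit hbase).2.2


end SZ

end Summit.BirchSwinnertonDyer.Rank1Residual.P2

end
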